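import Summits.QuantumFields.BalabanUV.T4Continuum.Spine.NE1p.DressedTransportUniformWin
import Summits.QuantumFields.BalabanUV.T4Continuum.Spine.NE1p.DressedRootFam

/-!
# T⁴ programme, spine estimate NE1′ (node O3b/H2) — THE ALL-CUTOFF FACE OVER THE WINDOW END: `DressedStability 𝒯` FROM THE
# DISPLAYED WALL BINDERS AT EVERY `(p, K)`, ONE SET OF K-∕μ-FREE SCALARS, RATIO-BOUNDED PER-STEP-WINDOW SCHEDULES
# (swarm item S3g «window face», part 2, of `t4/formal/NE1p/LEAVES.md` v2.3; INTENT CLAIMS.log l.9592 ∕ l.9664)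

Cell `pub-balaban`, sub-cell `t4`, BINDER-OWNERS row NE1′, formalisation crew `b2b-balaban-t4-ne1p-formalise-*`, seat `…-leaf-09`
(gen 2).  ADDITIVE — imports `Spine/NE1p/DressedTransportUniformWin` (S3g part 1: `bookingLeaves_win_of_schedule`, `κ_nonneg_win`,
`geometric_ratio_κ`) and `Spine/NE1p/DressedRootFam` (ROOT-B `DressedBudget`, `dressedBudget_of_dressedStabilityWith_strict`, p211697)
ONLY; modifies nothing.  Sibling of leaf-02's row S3e `DressedStabilityOfRatioSchedules` (the RATIO face: `hP` ASSEMBLED, schedules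
`WindowSchedule r w` with the K-linear window budget `K·w`); THIS module is the WINDOW face: `hP` DISPLAYED, schedules
`WindowScheduleWin r w` whose cutoff-free witness `geometric` may serve EVERY `(p, K)` at once.

WHAT THIS FILE DOES.  END-B (`DressedRoot.dressedStabilityWith_of_bookingLeaves`) consumes ONE `U : UniformConstants` and a bundle
`BookingLeaves U (𝒯.B p K) (𝒯.T p K)` at EVERY run parameter `p` and cutoff `K`; part 1's `bookingLeaves_win_of_schedule` builds
that bundle over `U := uniformConstantsCell L (4c_δ∕r) c̄ κ N₀ A₀ m s̄⁰ ρ′ …` from the displayed binders of ONE cutoff.  Here the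
binders are taken as `(p, K)`-FAMILIES — one per-step-window schedule `W p K : WindowScheduleWin r (w p K)` per `(p, K)`, the
END-F-win wall ∕ context family ((w1) `hsl`, H2 `hFn`∕`h𝒢`, (w2-act) `hB`∕`hE`, F-4 `hP`, `hDμ`, (I4′) `hdefwk`∕`hrate`, `hlin`,
`hinv`), the booking-level walls ((w5) `hreg` + `0 ≤ creg ≤ c̄`, (w2-act) `hs₀`, (w3-book) `hS`∕`hcount`, (w1)+(w5b) `hbirth`) and the
ratio family `hratio` — while the TWELVE SCALARS `κ L c̄ N₀ A₀ s̄⁰ ρ′ r c_δ m` (+ signs, (w7) `hloc`, (w6) `hsmall`) are bound ONCE,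
BEFORE `p` and `K`.  That quantifier order IS the content of the row root (RULING R-t4r2-Q2, caveat k1): nothing else happens here.
* §1 **`dressedStabilityWith_win_of_schedules … : DressedStabilityWith 𝒯 A₀ (rhoOne L⁻² (4c_δ∕r) c̄ κ) L⁻³`** (constants displayed;
  needs the sign `hκ`) and **`dressedStability_win_of_schedules … : DressedStability 𝒯`** (THE ROW ROOT literally; `hκ` read off
  `hratio` at any `(p, 0)`, the empty parameter type being trivial).
* §2 ROOT-B hand-off `dressedBudget_win_of_schedules … : DressedBudget 𝒯 wt` — with K-free positional counts `N₀·(L⁴)^{k−j}` of the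
  bookings and run weights `0 ≤ wt p K j ≤ w̄`, by `DressedRootFam.dressedBudget_of_dressedStabilityWith_strict` (strict product
  `L⁴·ρ₁·L⁻³ = locCell … ≤ ρ′ < 1`, `DressedUniformConstants.prod_cell`).
* §3 `hratio_geometric_all`: the SINGLE cutoff-free schedule `W p K := WindowScheduleWin.geometric r w q σ₀ ϱ₀ ρ∞` inhabits the ratio
  family with `κ := 2σ₀∕ϱ₀` for all `(p, K, k)` — so §1 applies with ONE schedule, and then the (w1) window `bondBall d (ρw k′)`
  displayed in `hsl` is the SAME finite ball at every cutoff (`geometric_birthWindow_ratio`, part 1 §4).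

LOCATED CAVEATS CARRIED (typer R-T26∕R-T27, DAG §3b; X(S1d) CLAIMS.log l.9652).  LF-2 = F-ne1pleaf04-1: cutoff-free windows hold for
THIS face because F-4 `hP` is DISPLAYED; the assembled faces (END-F′, END-F′-mod-win) re-introduce the uniform slice window `w` per met
step (`hN2cx`∕`hpairx`): «slice window uniform: K·w remains» there until leaf-04's row S1e lands.  LF-1's window half (row S1's
`WindowSchedule.window_budget`, `K·w`) concerns the RATIO face (S3d∕S3e), not this one; LF-1's floor half is absent (no floor).  X(S1d)
INFO-2: `hdefwk : defect b k′ k ≤ (W p K).wc k` is an ABSOLUTE-step guard (along `geometric`: `≤ 2σ₀q^k` for every generation), not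
implied by F-6's displayed relative rate `c_δψ^{k−k′}` — both displayed; the frame of the instantiated defects is the owner's §F∕§G
question.  The K-uniformity content of NE1′ now sits ENTIRELY in the validity of the displayed families at FIXED scalars (k1's intent).

HONEST FRAMING.  Kernel composition over hypothesis shapes ([folklore]; 0 sorry; 0 citations used as facts; no `def … : Prop`, no
structure naming a wall).  Headline (c4): «NE1′ (all cutoffs, all run parameters) ⇐ the DISPLAYED wall binders ∀ (p,K) incl. F-4 `hP` +
located largeness∕window + ratio-bounded per-step-window schedules (ONE cutoff-free schedule admissible); NOT proved; 0 binders
instantiated on Bałaban's densities»; the wall (w1), (w2-act) THE NUMBER ([Balaban1989LargeFieldII] (1.65) p. 375, (1.71)–(1.75)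
pp. 379–380: printed TYPE only), F-4, (w3)⁺, (w5), (w6), (w7)'s located largeness, F-6's rate stands; spine PROVED 0∕9.  Rung (B)+1 on
ONE finite four-torus — NOT infinite volume, NOT a mass gap, NOT OS on ℝ⁴, NOT Clay.  HONEST DEPENDENCY: continuum YM on T⁴ ⇐
BetaPertH ∧ nine spine estimates (0/9 proved); BetaPertH ⇐ (D1) ∧ (D4) ∧ CAP+tail; G-an2-4 gates asym, D1 and NE2/3/4.
-/

noncomputable section

namespace Summit.QuantumFields.BalabanUV.T4Continuum.NE1p.DressedStabilityOfWinSchedules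

open MeasureTheory Set Metric Finset
open scoped BigOperators
open Literature.MathematicalPhysics.QuantumFieldTheory.Balaban1983to89
open Literature.MathematicalPhysics.QuantumFieldTheory.Balaban1983to89.T4TermFormat
open Literature.MathematicalPhysics.QuantumFieldTheory.Balaban1983to89.T4GatedBooking
open Literature.MathematicalPhysics.QuantumFieldTheory.Balaban1983to89.T4TrajectoryComparison
open Literature.MathematicalPhysics.QuantumFieldTheory.Balaban1983to89.T4TrajectoryModulus
open T4BirthChartTransport (GaugeInvariant BirthSlice RelGauge)
open T4BlockTransport (Fld NDir latMove latN)
open T4TrajectoryDensity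
open Summit.QuantumFields.BalabanUV.T4Continuum.T4TrajectoryDensityDressed
open Summit.QuantumFields.BalabanUV.T4Continuum.NE1p.DressedRoot
open Summit.QuantumFields.BalabanUV.T4Continuum.NE1p.DressedWindowScheduleWin
open Summit.QuantumFields.BalabanUV.T4Continuum.NE1p.DressedUniformConstants
open Summit.QuantumFields.BalabanUV.T4Continuum.NE1p.DressedTransportUniformWin

/-! ## §1 The all-cutoff face: END-B over the window bundles, scalars first -/

section AllCutoffs

variable {P : Type*} (𝒯 : DressedTower P)
variable {R : Type*} [NormedRing R] [NormedAlgebra ℂ R] [MeasurableSpace R] {d : ℕ}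
  {F : Type*} [NormedAddCommGroup F] [NormedSpace ℂ F] [CompleteSpace F]

/-- **THE ROW ROOT WITH ITS CONSTANTS DISPLAYED, FROM THE DISPLAYED FAMILIES — WINDOW FACE** [bookkeeping]: the twelve K-∕μ-free
scalars of row S3 (`κ L c̄ N₀ A₀ s̄⁰ ρ′ r c_δ m`, signs, (w7) `locCell L (4c_δ∕r) c̄ κ ≤ ρ′ < 1`, (w6) `m·(N₀A₀(1−ρ′)⁻¹) ≤ 1 − s̄⁰`)
bound ONCE; then for EVERY run parameter `p` and cutoff `K` a per-step-window schedule `W p K` with ratio `2σ ≤ κ·ϱc` and the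
displayed binder families of part 1's `bookingLeaves_win_of_schedule` over the booking `𝒯.B p K` ∕ trajectory `𝒯.T p K` — (w1) `hsl`
on `bondBall d ((W p K).ρw k′)`, H2 `hFn`∕`h𝒢`, (w2-act) `hB`∕`hE` (printed TYPE only), F-4 `hP` (DISPLAYED), `hDμ`, (I4′) `hdefwk`∕
`hrate` at `ψ := L⁻²`, `hlin`, `hinv`, (w5) `hreg` + `hc0`∕`hcb`, (w2-act) `hs₀`, (w3-book) `hS`∕`hcount`, (w1)+(w5b) `hbirth` — give
`DressedStabilityWith 𝒯 A₀ (rhoOne L⁻² (4c_δ∕r) c̄ κ) L⁻³` by END-B `dressedStabilityWith_of_bookingLeaves` BY NAME over the ONE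
`uniformConstantsCell …`.  The order `∃ scalars, ∀ p K` is the content; nothing of Bałaban's densities is asserted. [folklore] -/
theorem dressedStabilityWith_win_of_schedules {κ L cbar N₀ A₀ sbar ρ' r cδ m : ℝ} {w : P → ℕ → ℝ}
    (W : ∀ p K, WindowScheduleWin r (w p K))
    {Fn : ∀ p K, (𝒯.B p K).Birth → ℕ → ℕ → Fld d R → F}
    {rel : ∀ p K, (𝒯.B p K).Birth → ℕ → ℕ → Fld d R → Fld d R → Prop}
    {ref : ∀ p K, (𝒯.B p K).Birth → ℕ → Fld d R → Fld d R} {base : ∀ p K, (𝒯.B p K).Birth → ℕ → Fld d R → ℝ}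
    {𝒜 𝒬 : ∀ p K, (𝒯.B p K).Birth → ℕ → Fld d R → Fld d R → ℂ} {q : ∀ p K, (𝒯.B p K).Birth → ℕ → Fld d R → ℂ}
    {μ : ∀ p K, (𝒯.B p K).Birth → ℕ → Measure (Fld d R)} {z₀ : ∀ p K, (𝒯.B p K).Birth → ℕ → Fld d R}
    {defect : ∀ p K, (𝒯.B p K).Birth → ℕ → ℕ → ℝ} {s : ∀ p K, (𝒯.B p K).Birth → ℕ → ℝ}
    {S : ∀ p K, ℕ → (𝒯.B p K).Birth → Finset (𝒯.B p K).Birth} {creg : P → ℕ → ℕ → ℝ}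
    -- the ratio family (K-free κ)
    (hratio : ∀ p K k, 2 * (W p K).σ k ≤ κ * (W p K).ϱc k)
    -- the twelve scalars' signs and row S3's located inequalities — ONCE
    (hL : 1 ≤ L) (hcbar : 0 ≤ cbar) (hκ : 0 ≤ κ) (hN₀ : 0 ≤ N₀) (hA₀ : 0 ≤ A₀) (hm : 0 ≤ m)
    (hloc : locCell L (4 * cδ / r) cbar κ ≤ ρ') (hρ'1 : ρ' < 1)
    (hsmall : m * (N₀ * A₀ * (1 - ρ')⁻¹) ≤ 1 - sbar) (hr : 0 < r) (hcδ : 0 ≤ cδ)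
    -- END-F-win's wall ∕ context families
    (hsl : ∀ p K, ∀ (b : (𝒯.B p K).Birth) (k' : ℕ), (𝒯.B p K).birthScale b ≤ k' → k' ≤ (𝒯.B p K).K →
      RanBelow (budgetGate (𝒯.T p K) (s p K) m (S p K) (4 * cδ / r)
        (fun i => (L ^ 2)⁻¹ * (fun _ : ℕ => alphaCell κ) i)) k' →
      BirthSlice (Fn p K b k' k') latMove latN (bondBall d ((W p K).ρw k') : Set (Fld d R)) (w p K) r
        ((𝒯.T p K).gen b k'))
    (hFn : ∀ p K, ∀ (b : (𝒯.B p K).Birth) (k' k : ℕ), (𝒯.B p K).birthScale b ≤ k' → k' ≤ k → k + 1 ≤ (𝒯.B p K).K →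
      RanBelow (budgetGate (𝒯.T p K) (s p K) m (S p K) (4 * cδ / r)
        (fun i => (L ^ 2)⁻¹ * (fun _ : ℕ => alphaCell κ) i)) (k + 1) →
      ∀ U, Fn p K b k' (k + 1) U =
        wOp (expWeight (base p K b k) (𝒜 p K b k + 𝒬 p K b k)) (μ p K b k) (z₀ p K b k) U
          (fun z => Fn p K b k' k (U + z)))
    (h𝒢 : ∀ p K, ∀ (b : (𝒯.B p K).Birth) (k' k : ℕ), (𝒯.B p K).birthScale b ≤ k' → k' ≤ k → k + 1 ≤ (𝒯.B p K).K →
      RanBelow (budgetGate (𝒯.T p K) (s p K) m (S p K) (4 * cδ / r)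
        (fun i => (L ^ 2)⁻¹ * (fun _ : ℕ => alphaCell κ) i)) (k + 1) →
      ∀ U, (fun z => Fn p K b k' k (U + z)) ∈ BddClass F (μ p K b k))
    (hB : ∀ p K, ∀ (b : (𝒯.B p K).Birth) (k' k : ℕ), (𝒯.B p K).birthScale b ≤ k' → k' ≤ k → k + 1 ≤ (𝒯.B p K).K →
      RanBelow (budgetGate (𝒯.T p K) (s p K) m (S p K) (4 * cδ / r)
        (fun i => (L ^ 2)⁻¹ * (fun _ : ℕ => alphaCell κ) i)) (k + 1) →
      RealBaseAt (ref p K b k) (base p K b k) (𝒜 p K b k) (μ p K b k)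
        (bondBall d ((W p K).ρw (k + 1)) : Set (Fld d R)))
    (hE : ∀ p K, ∀ (b : (𝒯.B p K).Birth) (k' k : ℕ), (𝒯.B p K).birthScale b ≤ k' → k' ≤ k → k + 1 ≤ (𝒯.B p K).K →
      RanBelow (budgetGate (𝒯.T p K) (s p K) m (S p K) (4 * cδ / r)
        (fun i => (L ^ 2)⁻¹ * (fun _ : ℕ => alphaCell κ) i)) (k + 1) →
      ExponentSliceAt (ref p K b k) (𝒜 p K b k) (μ p K b k) latMove latN
        (bondBall d ((W p K).ρw (k + 1)) : Set (Fld d R)) (w p K) ((W p K).ϱc k) (s p K b k))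
    (hP : ∀ p K, ∀ (b : (𝒯.B p K).Birth) (k' k : ℕ), (𝒯.B p K).birthScale b ≤ k' → k' ≤ k → k + 1 ≤ (𝒯.B p K).K →
      RanBelow (budgetGate (𝒯.T p K) (s p K) m (S p K) (4 * cδ / r)
        (fun i => (L ^ 2)⁻¹ * (fun _ : ℕ => alphaCell κ) i)) (k + 1) →
      PertSlice (fun U z => 𝒬 p K b k U z - q p K b k U) (μ p K b k) latMove latN
        (bondBall d ((W p K).ρw (k + 1)) : Set (Fld d R)) (w p K) ((W p K).ϱc k)
        (m * ∑ f ∈ S p K k b, (𝒯.T p K).envVar (4 * cδ / r) (fun i => (L ^ 2)⁻¹ * (fun _ : ℕ => alphaCell κ) i) f k))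
    (hDμ : ∀ p K, ∀ b k, ∀ᵐ z ∂μ p K b k, z ∈ (bondBall d ((W p K).σ k) : Set (Fld d R)))
    (hinv : ∀ p K, ∀ b k' k, GaugeInvariant (rel p K b k' k) (Fn p K b k' k))
    (hdefwk : ∀ p K, ∀ (_b : (𝒯.B p K).Birth) (_k' k : ℕ), defect p K _b _k' k ≤ (W p K).wc k)
    (hrate : ∀ p K, ∀ (b : (𝒯.B p K).Birth) (k' k : ℕ), (𝒯.B p K).birthScale b ≤ k' → k' ≤ k → k ≤ (𝒯.B p K).K →
      defect p K b k' k ≤ cδ * ((L ^ 2)⁻¹) ^ (k - k'))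
    (hlin : ∀ p K, ∀ (b : (𝒯.B p K).Birth) (k' k : ℕ), (𝒯.B p K).birthScale b ≤ k' → k' ≤ k → k ≤ (𝒯.B p K).K →
      RanBelow (budgetGate (𝒯.T p K) (s p K) m (S p K) (4 * cδ / r)
        (fun i => (L ^ 2)⁻¹ * (fun _ : ℕ => alphaCell κ) i)) k →
      ∀ ε > 0, ∃ U₀ ∈ (bondBall d ((W p K).ρw k) : Set (Fld d R)), ∃ U₁ : Fld d R,
        RelGauge (rel p K b k' k) latMove latN U₀ U₁ (defect p K b k' k) ∧
        (𝒯.T p K).lin b k' k ≤ ‖Fn p K b k' k U₁ - Fn p K b k' k U₀‖ + ε)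
    -- the booking-level wall families
    (hc0 : ∀ p K k, 0 ≤ creg p K k) (hcb : ∀ p K k, k < (𝒯.B p K).K → creg p K k ≤ cbar)
    (hreg : ∀ p K, (𝒯.T p K).RegeneratesFromVar (creg p K)
      (budgetGate (𝒯.T p K) (s p K) m (S p K) (4 * cδ / r) (fun _ : ℕ => (L ^ 2)⁻¹ * alphaCell κ)))
    (hs₀ : ∀ p K, ∀ b k, s p K b k ≤ sbar)
    (hS : ∀ p K, ∀ k b, ∀ f ∈ S p K k b, (𝒯.B p K).birthScale f ≤ k)
    (hcount : ∀ p K, ∀ k b, ∀ j ≤ k,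
      (((S p K k b).filter fun f => (𝒯.B p K).birthScale f = j).card : ℝ) ≤ N₀ * (L ^ 4) ^ (k - j))
    (hbirth : ∀ p K, (𝒯.T p K).BirthsFromOld (4 * cδ / r) (fun _ : ℕ => (L ^ 2)⁻¹ * alphaCell κ)
      (twoRate A₀ (rhoOne (L ^ 2)⁻¹ (4 * cδ / r) cbar κ) (L⁻¹ ^ 3) (𝒯.B p K).K)
      (budgetGate (𝒯.T p K) (s p K) m (S p K) (4 * cδ / r) (fun _ : ℕ => (L ^ 2)⁻¹ * alphaCell κ))) :
    DressedStabilityWith 𝒯 A₀ (rhoOne (L ^ 2)⁻¹ (4 * cδ / r) cbar κ) (L⁻¹ ^ 3) :=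
  dressedStabilityWith_of_bookingLeaves
    (uniformConstantsCell L (4 * cδ / r) cbar κ N₀ A₀ m sbar ρ' hL (div_nonneg (mul_nonneg (by norm_num) hcδ) hr.le) hcbar
      hκ hN₀ hA₀ hm hloc hρ'1 hsmall)
    𝒯 fun p K =>
      bookingLeaves_win_of_schedule (W p K) (hratio p K) hL hcbar hN₀ hA₀ hm hloc hρ'1 hsmall hr hcδ (hsl p K) (hFn p K)
        (h𝒢 p K) (hB p K) (hE p K) (hP p K) (hDμ p K) (hinv p K) (hdefwk p K) (hrate p K) (hlin p K) (hc0 p K) (hcb p K)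
        (hreg p K) (hs₀ p K) (hS p K) (hcount p K) (hbirth p K)

/-- **THE ROW ROOT — `DressedStability 𝒯` — FROM THE DISPLAYED FAMILIES, WINDOW FACE** [bookkeeping]: as
`dressedStabilityWith_win_of_schedules`, conclusion LITERALLY `DressedRoot.DressedStability 𝒯`; the sign `0 ≤ κ` is read off the
ratio family at any `(p, 0)` (for an empty parameter type the root holds with the zero constants).  «NE1′ (all cutoffs, all run
parameters) ⇐ the displayed wall binders ∀ (p,K) + located largeness + ratio-bounded per-step-window schedules»; NOT proved; nothing
instantiated on Bałaban's densities. [folklore] -/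
theorem dressedStability_win_of_schedules {κ L cbar N₀ A₀ sbar ρ' r cδ m : ℝ} {w : P → ℕ → ℝ}
    (W : ∀ p K, WindowScheduleWin r (w p K))
    {Fn : ∀ p K, (𝒯.B p K).Birth → ℕ → ℕ → Fld d R → F}
    {rel : ∀ p K, (𝒯.B p K).Birth → ℕ → ℕ → Fld d R → Fld d R → Prop}
    {ref : ∀ p K, (𝒯.B p K).Birth → ℕ → Fld d R → Fld d R} {base : ∀ p K, (𝒯.B p K).Birth → ℕ → Fld d R → ℝ}
    {𝒜 𝒬 : ∀ p K, (𝒯.B p K).Birth → ℕ → Fld d R → Fld d R → ℂ} {q : ∀ p K, (𝒯.B p K).Birth → ℕ → Fld d R → ℂ}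
    {μ : ∀ p K, (𝒯.B p K).Birth → ℕ → Measure (Fld d R)} {z₀ : ∀ p K, (𝒯.B p K).Birth → ℕ → Fld d R}
    {defect : ∀ p K, (𝒯.B p K).Birth → ℕ → ℕ → ℝ} {s : ∀ p K, (𝒯.B p K).Birth → ℕ → ℝ}
    {S : ∀ p K, ℕ → (𝒯.B p K).Birth → Finset (𝒯.B p K).Birth} {creg : P → ℕ → ℕ → ℝ}
    (hratio : ∀ p K k, 2 * (W p K).σ k ≤ κ * (W p K).ϱc k)
    (hL : 1 ≤ L) (hcbar : 0 ≤ cbar) (hN₀ : 0 ≤ N₀) (hA₀ : 0 ≤ A₀) (hm : 0 ≤ m)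
    (hloc : locCell L (4 * cδ / r) cbar κ ≤ ρ') (hρ'1 : ρ' < 1)
    (hsmall : m * (N₀ * A₀ * (1 - ρ')⁻¹) ≤ 1 - sbar) (hr : 0 < r) (hcδ : 0 ≤ cδ)
    (hsl : ∀ p K, ∀ (b : (𝒯.B p K).Birth) (k' : ℕ), (𝒯.B p K).birthScale b ≤ k' → k' ≤ (𝒯.B p K).K →
      RanBelow (budgetGate (𝒯.T p K) (s p K) m (S p K) (4 * cδ / r)
        (fun i => (L ^ 2)⁻¹ * (fun _ : ℕ => alphaCell κ) i)) k' →
      BirthSlice (Fn p K b k' k') latMove latN (bondBall d ((W p K).ρw k') : Set (Fld d R)) (w p K) r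
        ((𝒯.T p K).gen b k'))
    (hFn : ∀ p K, ∀ (b : (𝒯.B p K).Birth) (k' k : ℕ), (𝒯.B p K).birthScale b ≤ k' → k' ≤ k → k + 1 ≤ (𝒯.B p K).K →
      RanBelow (budgetGate (𝒯.T p K) (s p K) m (S p K) (4 * cδ / r)
        (fun i => (L ^ 2)⁻¹ * (fun _ : ℕ => alphaCell κ) i)) (k + 1) →
      ∀ U, Fn p K b k' (k + 1) U =
        wOp (expWeight (base p K b k) (𝒜 p K b k + 𝒬 p K b k)) (μ p K b k) (z₀ p K b k) U
          (fun z => Fn p K b k' k (U + z)))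
    (h𝒢 : ∀ p K, ∀ (b : (𝒯.B p K).Birth) (k' k : ℕ), (𝒯.B p K).birthScale b ≤ k' → k' ≤ k → k + 1 ≤ (𝒯.B p K).K →
      RanBelow (budgetGate (𝒯.T p K) (s p K) m (S p K) (4 * cδ / r)
        (fun i => (L ^ 2)⁻¹ * (fun _ : ℕ => alphaCell κ) i)) (k + 1) →
      ∀ U, (fun z => Fn p K b k' k (U + z)) ∈ BddClass F (μ p K b k))
    (hB : ∀ p K, ∀ (b : (𝒯.B p K).Birth) (k' k : ℕ), (𝒯.B p K).birthScale b ≤ k' → k' ≤ k → k + 1 ≤ (𝒯.B p K).K →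
      RanBelow (budgetGate (𝒯.T p K) (s p K) m (S p K) (4 * cδ / r)
        (fun i => (L ^ 2)⁻¹ * (fun _ : ℕ => alphaCell κ) i)) (k + 1) →
      RealBaseAt (ref p K b k) (base p K b k) (𝒜 p K b k) (μ p K b k)
        (bondBall d ((W p K).ρw (k + 1)) : Set (Fld d R)))
    (hE : ∀ p K, ∀ (b : (𝒯.B p K).Birth) (k' k : ℕ), (𝒯.B p K).birthScale b ≤ k' → k' ≤ k → k + 1 ≤ (𝒯.B p K).K →
      RanBelow (budgetGate (𝒯.T p K) (s p K) m (S p K) (4 * cδ / r)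
        (fun i => (L ^ 2)⁻¹ * (fun _ : ℕ => alphaCell κ) i)) (k + 1) →
      ExponentSliceAt (ref p K b k) (𝒜 p K b k) (μ p K b k) latMove latN
        (bondBall d ((W p K).ρw (k + 1)) : Set (Fld d R)) (w p K) ((W p K).ϱc k) (s p K b k))
    (hP : ∀ p K, ∀ (b : (𝒯.B p K).Birth) (k' k : ℕ), (𝒯.B p K).birthScale b ≤ k' → k' ≤ k → k + 1 ≤ (𝒯.B p K).K →
      RanBelow (budgetGate (𝒯.T p K) (s p K) m (S p K) (4 * cδ / r)
        (fun i => (L ^ 2)⁻¹ * (fun _ : ℕ => alphaCell κ) i)) (k + 1) →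
      PertSlice (fun U z => 𝒬 p K b k U z - q p K b k U) (μ p K b k) latMove latN
        (bondBall d ((W p K).ρw (k + 1)) : Set (Fld d R)) (w p K) ((W p K).ϱc k)
        (m * ∑ f ∈ S p K k b, (𝒯.T p K).envVar (4 * cδ / r) (fun i => (L ^ 2)⁻¹ * (fun _ : ℕ => alphaCell κ) i) f k))
    (hDμ : ∀ p K, ∀ b k, ∀ᵐ z ∂μ p K b k, z ∈ (bondBall d ((W p K).σ k) : Set (Fld d R)))
    (hinv : ∀ p K, ∀ b k' k, GaugeInvariant (rel p K b k' k) (Fn p K b k' k))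
    (hdefwk : ∀ p K, ∀ (_b : (𝒯.B p K).Birth) (_k' k : ℕ), defect p K _b _k' k ≤ (W p K).wc k)
    (hrate : ∀ p K, ∀ (b : (𝒯.B p K).Birth) (k' k : ℕ), (𝒯.B p K).birthScale b ≤ k' → k' ≤ k → k ≤ (𝒯.B p K).K →
      defect p K b k' k ≤ cδ * ((L ^ 2)⁻¹) ^ (k - k'))
    (hlin : ∀ p K, ∀ (b : (𝒯.B p K).Birth) (k' k : ℕ), (𝒯.B p K).birthScale b ≤ k' → k' ≤ k → k ≤ (𝒯.B p K).K →
      RanBelow (budgetGate (𝒯.T p K) (s p K) m (S p K) (4 * cδ / r)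
        (fun i => (L ^ 2)⁻¹ * (fun _ : ℕ => alphaCell κ) i)) k →
      ∀ ε > 0, ∃ U₀ ∈ (bondBall d ((W p K).ρw k) : Set (Fld d R)), ∃ U₁ : Fld d R,
        RelGauge (rel p K b k' k) latMove latN U₀ U₁ (defect p K b k' k) ∧
        (𝒯.T p K).lin b k' k ≤ ‖Fn p K b k' k U₁ - Fn p K b k' k U₀‖ + ε)
    (hc0 : ∀ p K k, 0 ≤ creg p K k) (hcb : ∀ p K k, k < (𝒯.B p K).K → creg p K k ≤ cbar)
    (hreg : ∀ p K, (𝒯.T p K).RegeneratesFromVar (creg p K)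
      (budgetGate (𝒯.T p K) (s p K) m (S p K) (4 * cδ / r) (fun _ : ℕ => (L ^ 2)⁻¹ * alphaCell κ)))
    (hs₀ : ∀ p K, ∀ b k, s p K b k ≤ sbar)
    (hS : ∀ p K, ∀ k b, ∀ f ∈ S p K k b, (𝒯.B p K).birthScale f ≤ k)
    (hcount : ∀ p K, ∀ k b, ∀ j ≤ k,
      (((S p K k b).filter fun f => (𝒯.B p K).birthScale f = j).card : ℝ) ≤ N₀ * (L ^ 4) ^ (k - j))
    (hbirth : ∀ p K, (𝒯.T p K).BirthsFromOld (4 * cδ / r) (fun _ : ℕ => (L ^ 2)⁻¹ * alphaCell κ)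
      (twoRate A₀ (rhoOne (L ^ 2)⁻¹ (4 * cδ / r) cbar κ) (L⁻¹ ^ 3) (𝒯.B p K).K)
      (budgetGate (𝒯.T p K) (s p K) m (S p K) (4 * cδ / r) (fun _ : ℕ => (L ^ 2)⁻¹ * alphaCell κ))) :
    DressedStability 𝒯 := by
  rcases isEmpty_or_nonempty P with hPe | ⟨⟨p₀⟩⟩
  · exact ⟨0, 0, 0, le_rfl, le_rfl, le_rfl, zero_le_one, fun p _ => isEmptyElim p⟩
  · exact ⟨_, _, _, dressedStabilityWith_win_of_schedules 𝒯 W hratio hL hcbar (κ_nonneg_win (W p₀ 0) (hratio p₀ 0)) hN₀ hA₀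
      hm hloc hρ'1 hsmall hr hcδ hsl hFn h𝒢 hB hE hP hDμ hinv hdefwk hrate hlin hc0 hcb hreg hs₀ hS hcount hbirth⟩

end AllCutoffs

/-! ## §2 ROOT-B hand-off: the budget at every cube of every cutoff -/

section Budget

variable {P : Type*} {𝒯 : DressedTower P}

/-- **ROOT-C ⟹ ROOT-B OVER THE CELL'S CONSTANTS** [bookkeeping]: the root with the constants of §1 displayed, K-free positional counts
`N₀·(L⁴)^{k−j}` of the bookings (`Booking.PositionalCount`, row S4's format at the booking level) and run weight profiles
`0 ≤ wt p K j ≤ w̄` give `DressedBudget 𝒯 wt` with `c_B = w̄·N₀A₀∕(1−ρ′)` — `DressedRootFam.dressedBudget_of_dressedStabilityWith_strict`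
BY NAME, the strict product being row S3's located (w7): `L⁴·ρ₁·L⁻³ = locCell L (4c_δ∕r) c̄ κ ≤ ρ′ < 1` (`prod_cell`). [folklore] -/
theorem dressedBudget_win_of_cell {κ L cbar N₀ A₀ ρ' r cδ wbar : ℝ} {wt : P → ℕ → ℕ → ℝ}
    (h : DressedStabilityWith 𝒯 A₀ (rhoOne (L ^ 2)⁻¹ (4 * cδ / r) cbar κ) (L⁻¹ ^ 3))
    (hL : 1 ≤ L) (hN₀ : 0 ≤ N₀) (hloc : locCell L (4 * cδ / r) cbar κ ≤ ρ') (hρ'1 : ρ' < 1) (hwbar : 0 ≤ wbar)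
    (hw0 : ∀ p K, ∀ j ≤ K, 0 ≤ wt p K j) (hwb : ∀ p K, ∀ j ≤ K, wt p K j ≤ wbar)
    (hcount : ∀ p K, (𝒯.B p K).PositionalCount fun j k => N₀ * (L ^ 4) ^ (k - j)) :
    DressedBudget 𝒯 wt :=
  dressedBudget_of_dressedStabilityWith_strict h hN₀ (pow_nonneg (by linarith) 4)
    (by rw [prod_cell (by linarith)]; exact hloc) hρ'1 hwbar hw0 hwb hcount

end Budget

/-! ## §3 ONE cutoff-free schedule for every `(p, K)` -/

section OneSchedule

variable {P : Type*}

/-- [decided toy] The SINGLE cutoff-free schedule `W p K := WindowScheduleWin.geometric r w q σ₀ ϱ₀ ρ∞` (the same at every run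
parameter and cutoff) inhabits §1's ratio family with the K-free `κ := 2σ₀∕ϱ₀` (part 1's `geometric_ratio_κ`) — so §1 applies with ONE
schedule, ONE `uniformConstantsCell … (2σ₀∕ϱ₀) …`, and the (w1) window `bondBall d (ρw k′) ⊆ bondBall d (ρ∞ + (1+2q)σ₀∕(1−q))`
displayed in `hsl` is the same finite ball at EVERY cutoff (part 1 `geometric_birthWindow_ratio`; LF-2: for this `hP`-displayed face).
[folklore] -/
theorem hratio_geometric_all {r w q σ₀ ϱ₀ ρinf : ℝ} (hq0 : 0 < q) (hq1 : q < 1) (hσ₀ : 0 < σ₀) (hσ₀w : 2 * σ₀ ≤ w)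
    (hϱ₀ : 0 < ϱ₀) :
    ∀ (_p : P) (_K k : ℕ),
      2 * ((fun (_ : P) (_ : ℕ) => WindowScheduleWin.geometric r w q σ₀ ϱ₀ ρinf hq0 hq1 hσ₀ hσ₀w hϱ₀) _p _K).σ k ≤
        (2 * σ₀ / ϱ₀) * ((fun (_ : P) (_ : ℕ) => WindowScheduleWin.geometric r w q σ₀ ϱ₀ ρinf hq0 hq1 hσ₀ hσ₀w hϱ₀) _p _K).ϱc k :=
  fun _ _ k => geometric_ratio_κ hq0 hq1 hσ₀ hσ₀w hϱ₀ k

end OneSchedule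

end Summit.QuantumFields.BalabanUV.T4Continuum.NE1p.DressedStabilityOfWinSchedules

end
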